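import Mathlib
import Summits.NavierStokesRegularity.NavierStokesRegularity.Theorems.EulerZoomLiouvillePowerGaugeEulerLiouvilleSwirlfreeLedgerFlow
import Summits.NavierStokesRegularity.NavierStokesRegularity.Theorems.EulerZoomLiouvillePowerGaugeEulerLiouvilleSwirlfreeLedgerConfinement
import Literature.Analysis.FluidPDE.AncientMildWeakStar
import Literature.Analysis.FluidPDE.ClassicalSolution
import Literature.Analysis.FluidPDE.AxisymmetricEuler
import Literature.Analysis.FluidPDE.AxisymQuotientBounds
import HarnessLib

/-!
# Crux `EulerZoomLiouville.PowerGaugeEulerLiouville` (stmt-NavierStokesRegularity-19832), line `mirror-moment`, stub M2: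
# LEDGER BLOBS PERSIST BACKWARD, LOCATION-FREE (`stub_blobPersistence`, signature unfolded)

Route №10 `EulerZoomLiouville` (NavierStokesRegularity), crux E.  Line `mirror-moment` (ideator ns-idea-11 g3;
`Cruxes/PowerGaugeEulerLiouville/Lines/mirror_moment.lean`), registered stub `stub_blobPersistence` (M2, «M»): `IsMirrorOutgoingWith u p R₀ β →
BlobsPersist u`, proved here with the line's `IsMirrorOutgoingWith`, `BlobsPersist`, `axisLedger v x = ‖curl v x‖ / cylRadius x`,
`reflZ x = x − (2 x₂) e_z` δ-UNFOLDED (so the skeleton fills the stub by `exact`).  Seat ns-ezl-w3 (default pick; the critic's staffing note had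
this line with the `casimir-floor` prover, whose K1 `CasimirFloor.ledgerBlobsPersist_of_swirlFreeDriftingWith` this file RE-CUTS).

THE STATEMENT.  For a classical mirror-outgoing member (classical Euler on `(−∞,0) × ℝ³`, axisymmetric swirl-free slices, …, velocity bounded on
every compact past time-slab), every late off-axis ball `B(x₀, δ)` (`δ < r(x₀)`) at time `t₀ < 0` on which the ledger density
`η(t₀) = |curl u(t₀)|/r ≤ W` has, at each earlier time `τ`, a measurable avatar `T` on which `0 < η(τ) ≤ W` and whose ledger mass is at least the
ball's: `∫_{B(x₀,δ)} η(t₀) ≤ ∫_T η(τ)`.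

THE PROOF (the sibling K1's Lagrangian one, location-free).  The slab bound `‖u‖ ≤ B` on `[τ, t₀] × ℝ³` is the speed bound of the flow kit with
exponent `κ = 0` (`norm_evolutionMap_sub_le`: displacement `≤ B(t₀ − τ)`), so the flow `φ` of the cut-off field `χu` (`χ = 1` on a ball containing
all parcels of `B(x₀,δ)`) IS the Euler flow on those parcels; they stay off the axis (`cylRadius_evolutionMap_ne_zero`) and carry `ω_θ/r`
(`omegaTilde_evolutionMap_eq`, `div_cylRadius_eq_abs_omegaTilde`), so `η` is transported POINTWISE; `det Dφ = 1`
(`det_fderiv_evolutionMap_eq_one_of_divergence`) and `lintegral_comp_evolutionMap_le` carry the mass.  The avatar is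
`T = φ(τ, t₀, B(x₀,δ) ∩ {η(t₀) > 0})` (`{η(t₀) > 0} = {curl u(t₀) ≠ 0}` off the axis, open by continuity of the curl of a `C²` field), so that
`η(τ) > 0` on it; the part of the ball where `η(t₀) = 0` carries no mass.

WHAT THIS IS NOT: not NS, not the crux — a helper `--supports` stmt-19832 on the line `mirror-moment` (M1, the lever, and M4 are not claimed here;
M5 is the open residue); 19832 is a crux CLASS of Euler/NS strata and stays OPEN; nothing here bears on NS regularity.
[cite: MajdaBertozziCUP2002, §2.3.3 (2.58)–(2.59), §1.3 Prop. 1.4, §4.2 (4.48)]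
-/

noncomputable section

-- flat `Theorems/<Route><Decl>…` files of one crux share the namespace of the crux (tree convention)
set_option linter.dupNamespace false

open MeasureTheory Set Filter Topology Metric Function
open scoped NNReal ENNReal ContDiff

namespace Summit.NavierStokesRegularity.NavierStokesRegularity.Theorems.PowerGaugeEulerLiouville.MirrorMoment

open Literature.Analysis Literature.Analysis.FluidPDE
open Summit.NavierStokesRegularity.NavierStokesRegularity.Theorems.PowerGaugeEulerLiouville.SwirlfreeLedger

/-- **M2 `stub_blobPersistence` of the line `mirror-moment`, signature unfolded** (`IsMirrorOutgoingWith u p R₀ β → BlobsPersist u` with the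
line's abbreviations written out): on the classical mirror-outgoing stratum every late off-axis blob `B(x₀, δ)` (`δ < r(x₀)`) at time `t₀ < 0`
with ledger density `≤ W` has at each earlier time `τ` a measurable avatar on which `0 < η(τ) ≤ W` and with at least the same ledger mass
(`T` = backward flow image of the ball's `{η(t₀) > 0}` part; proof in the module docstring).
[cite: MajdaBertozziCUP2002, §2.3.3 (2.58)–(2.59), §1.3 Prop. 1.4] -/
theorem blobsPersist_of_mirrorOutgoingWith :
    ∀ (u : ℝ → EuclideanSpace ℝ (Fin 3) → EuclideanSpace ℝ (Fin 3)) (p : ℝ → EuclideanSpace ℝ (Fin 3) → ℝ) (R₀ β : ℝ),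
      (IsClassicalEulerSolutionOn (Set.Iio 0) 0 u p ∧
        (∀ τ : ℝ, τ < 0 → IsAxisymmetric (u τ) ∧ HasNoSwirl (u τ)) ∧
        (∀ τ : ℝ, τ < 0 → ∀ x : EuclideanSpace ℝ (Fin 3),
          u τ (x - (2 * x 2) • (eZ : EuclideanSpace ℝ (Fin 3))) = u τ x - (2 * u τ x 2) • (eZ : EuclideanSpace ℝ (Fin 3))) ∧
        (∀ τ : ℝ, τ < 0 → ∀ x : EuclideanSpace ℝ (Fin 3), 0 ≤ x 2 * swirl (curl (u τ)) x) ∧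
        0 ≤ R₀ ∧ 0 ≤ β ∧
        (∀ τ : ℝ, τ < 0 → ∀ x : EuclideanSpace ℝ (Fin 3), R₀ * (1 + -τ) ^ β < cylRadius x → curl (u τ) x = 0) ∧
        (∀ τ : ℝ, τ < 0 →
          Integrable (fun x : EuclideanSpace ℝ (Fin 3) => (1 + ‖x‖) * ‖u τ x‖ ^ 2) ∧
            Integrable (fun x : EuclideanSpace ℝ (Fin 3) => (1 + ‖x‖) * (‖curl (u τ) x‖ / cylRadius x))) ∧
        (∀ T T' : ℝ, T ≤ T' → T' < 0 → ∃ B : ℝ, ∀ τ ∈ Set.Icc T T', ∀ x : EuclideanSpace ℝ (Fin 3), ‖u τ x‖ ≤ B)) →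
      ∀ t₀ : ℝ, t₀ < 0 → ∀ (x₀ : EuclideanSpace ℝ (Fin 3)) (δ W : ℝ), 0 < δ → δ < cylRadius x₀ →
        (∀ x ∈ ball x₀ δ, ‖curl (u t₀) x‖ / cylRadius x ≤ W) →
        ∀ τ : ℝ, τ < t₀ →
          ∃ T : Set (EuclideanSpace ℝ (Fin 3)), MeasurableSet T ∧
            (∀ y ∈ T, 0 < ‖curl (u τ) y‖ / cylRadius y ∧ ‖curl (u τ) y‖ / cylRadius y ≤ W) ∧
            ∫⁻ x in ball x₀ δ, ENNReal.ofReal (‖curl (u t₀) x‖ / cylRadius x) ≤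
              ∫⁻ y in T, ENNReal.ofReal (‖curl (u τ) y‖ / cylRadius y) := by
  intro u p R₀ β hstr t₀ ht₀ x₀ δ W hδ hδr hηW t₁ ht₁
  obtain ⟨hcl, hsym, -, -, -, -, -, -, hbdd⟩ := hstr
  -- the slab speed bound `‖u‖ ≤ M` on `[t₁, t₀]`, written as the kit's bound with exponent `κ = 0`
  obtain ⟨B, hB⟩ := hbdd t₁ t₀ ht₁.le ht₀
  set M : ℝ := max B 0 with hMdef
  have hM0 : 0 ≤ M := le_max_right _ _
  have hM : ∀ s ∈ Icc t₁ t₀, ∀ x : EuclideanSpace ℝ (Fin 3), ‖u s x‖ ≤ M * (-s) ^ (-(0 : ℝ)) := by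
    intro s hs x
    rw [neg_zero, Real.rpow_zero, mul_one]
    exact (hB s hs x).trans (le_max_left _ _)
  -- the drift radius `D = M (t₀ - t₁)` and the confinement radius `Rc`
  set D : ℝ := M * (t₀ - t₁) with hD
  have hD0 : 0 ≤ D := mul_nonneg hM0 (by linarith)
  have hmono : ∀ s ∈ Icc t₁ t₀, M / (1 - 0) * ((-s) ^ (1 - (0 : ℝ)) - (-t₀) ^ (1 - (0 : ℝ))) ≤ D := by
    intro s hs
    rw [sub_zero, Real.rpow_one, Real.rpow_one, div_one, hD]
    exact mul_le_mul_of_nonneg_left (by linarith [hs.1]) hM0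
  set Rc : ℝ := ‖x₀‖ + δ + D with hRc
  have hRc0 : 0 < Rc := by positivity
  -- the times
  set S : Set ℝ := Set.Ioo (t₁ - 1) (t₀ / 2) with hS
  have hSo : IsOpen S := isOpen_Ioo
  have hSc : Convex ℝ S := convex_Ioo _ _
  have ht₀S : t₀ ∈ S := ⟨by linarith, by linarith⟩
  have ht₁S : t₁ ∈ S := ⟨by linarith, by linarith⟩
  have hSneg : S ⊆ Set.Iio 0 := fun s hs => lt_trans hs.2 (by linarith)
  have hclS : IsClassicalEulerSolutionOn S 0 u p := hcl.mono hSneg hSo.uniqueDiffOn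
  have hsymS : ∀ s ∈ S, IsAxisymmetric (u s) := fun s hs => (hsym s (hSneg hs)).1
  have hswS : ∀ s ∈ S, HasNoSwirl (u s) := fun s hs => (hsym s (hSneg hs)).2
  -- the cut-off flow
  set χ : ContDiffBump (0 : EuclideanSpace ℝ (Fin 3)) := ⟨Rc + 1, Rc + 2, by linarith, by linarith⟩ with hχ
  have hrIn : χ.rIn = Rc + 1 := rfl
  have hwsmooth : IsSmoothSpaceTimeOn S (fun t z => χ z • u t z) := isSmoothSpaceTimeOn_bump_smul χ hclS.smooth_velocity
  have hL : ODE.IsUniformlyLipschitzOn (fun t z => χ z • u t z) S := isUniformlyLipschitzOn_bump_smul χ hSo hclS.smooth_velocity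
  have hspeed : ∀ s ∈ Icc t₁ t₀, ∀ y, ‖(fun t z => χ z • u t z) s y‖ ≤ M * (-s) ^ (-(0 : ℝ)) := fun s hs y =>
    (norm_bump_smul_le χ (u s) y).trans (hM s hs y)
  -- confinement of the parcels of `B(x₀, δ)`
  have hconf : ∀ x ∈ ball x₀ δ, ∀ s ∈ Icc t₁ t₀, ‖ODE.evolutionMap (fun t z => χ z • u t z) t₀ s x‖ < Rc := by
    intro x hx s hs
    have hd := norm_evolutionMap_sub_le hL hSc hSo ht₁S ht₀S ht₀ (by norm_num : (0 : ℝ) < 1) hspeed x hs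
    have hxn : ‖x‖ < ‖x₀‖ + δ := by
      have h1 : ‖x - x₀‖ < δ := mem_ball_iff_norm.1 hx
      linarith [norm_le_norm_add_norm_sub' x x₀]
    calc ‖ODE.evolutionMap (fun t z => χ z • u t z) t₀ s x‖
        ≤ ‖x‖ + ‖ODE.evolutionMap (fun t z => χ z • u t z) t₀ s x - x‖ := norm_le_norm_add_norm_sub' _ _
      _ < ‖x₀‖ + δ + D := add_lt_add_of_lt_of_le hxn (hd.trans (hmono s hs))
  have hconf_in : ∀ x ∈ ball x₀ δ, ∀ s ∈ Icc t₁ t₀,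
      ODE.evolutionMap (fun t z => χ z • u t z) t₀ s x ∈ ball (0 : EuclideanSpace ℝ (Fin 3)) χ.rIn := by
    intro x hx s hs
    rw [mem_ball_zero_iff, hrIn]
    linarith [hconf x hx s hs]
  -- the axis
  have haxisw : ∀ s ∈ S, ∀ z : EuclideanSpace ℝ (Fin 3), z 0 = 0 → z 1 = 0 →
      (fun t z => χ z • u t z) s z 0 = 0 ∧ (fun t z => χ z • u t z) s z 1 = 0 := by
    intro s hs z hz0 hz1
    have h := Wei2016.apply_zero_one_eq_zero_of_axis (hsymS s hs) hz0 hz1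
    simp [h.1, h.2]
  -- the blob is off the axis
  have hoff : ∀ x ∈ ball x₀ δ, cylRadius x ≠ 0 := by
    intro x hx h0
    have h1 := cylRadius_le_cylRadius_add_norm_sub x x₀
    have h2 : ‖x₀ - x‖ < δ := by rw [← dist_eq_norm, dist_comm]; exact hx
    rw [h0, zero_add] at h1
    linarith
  -- incompressibility along confined trajectories
  have hdet : ∀ x ∈ ball x₀ δ, (fderiv ℝ (ODE.evolutionMap (fun t z => χ z • u t z) t₀ t₁) x).det = 1 := by
    intro x hx
    refine det_fderiv_evolutionMap_eq_one_of_divergence hL hwsmooth hSc hSo.uniqueDiffOn ht₀S ht₁S x fun s hs => ?_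
    rw [uIcc_of_ge ht₁.le] at hs
    have hsS : s ∈ S := hSc.ordConnected.out ht₁S ht₀S hs
    have hball := hconf_in x hx s hs
    have h0 := hclS.divFree s hsS (ODE.evolutionMap (fun t z => χ z • u t z) t₀ s x)
    unfold VectorCalculus.divergence at h0 ⊢
    rwa [fderiv_bump_smul_eq χ (u s) hball]
  -- the density is transported pointwise along the parcels of the blob
  have hC2 : ∀ τ : ℝ, τ < 0 → ContDiff ℝ 2 (u τ) := fun τ hτ => (hcl.contDiff_velocity hτ).of_le (by norm_cast)
  have ht₁0 : t₁ < 0 := lt_trans ht₁ ht₀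
  have htrans : ∀ x ∈ ball x₀ δ,
      ‖curl (u t₁) (ODE.evolutionMap (fun t z => χ z • u t z) t₀ t₁ x)‖ /
          cylRadius (ODE.evolutionMap (fun t z => χ z • u t z) t₀ t₁ x) = ‖curl (u t₀) x‖ / cylRadius x := by
    intro x hx
    have hxoff := hoff x hx
    have hΦoff : cylRadius (ODE.evolutionMap (fun t z => χ z • u t z) t₀ t₁ x) ≠ 0 :=
      cylRadius_evolutionMap_ne_zero hL hSc haxisw ht₀S ht₁S hxoff
    have htr := omegaTilde_evolutionMap_eq hclS hSo hSc hsymS hswS χ ht₁S ht₀S ht₁.le hxoff (hconf_in x hx)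
    have e0 := div_cylRadius_eq_abs_omegaTilde (hsym t₀ ht₀).1 (hsym t₀ ht₀).2 (hC2 t₀ ht₀) hxoff
    have e1 := div_cylRadius_eq_abs_omegaTilde (hsym t₁ ht₁0).1 (hsym t₁ ht₁0).2 (hC2 t₁ ht₁0) hΦoff
    rw [e0, e1]
    simp only [vorticity_apply] at htr
    rw [htr]
  -- the positive part of the blob: `{η(t₀) > 0} ∩ B(x₀, δ)` is measurable (the curl of a `C²` field is continuous)
  set P : Set (EuclideanSpace ℝ (Fin 3)) := {x | 0 < ‖curl (u t₀) x‖ / cylRadius x} with hP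
  have hcurlc : Continuous (curl (u t₀)) :=
    (contDiff_curl_of_succ (n := 1) (u := u t₀)
      (by rw [show ((1 : ℕ∞) : WithTop ℕ∞) + 1 = 2 from one_add_one_eq_two]; exact hC2 t₀ ht₀)).continuous
  have hηm : Measurable fun x : EuclideanSpace ℝ (Fin 3) => ‖curl (u t₀) x‖ / cylRadius x :=
    hcurlc.norm.measurable.div continuous_cylRadius.measurable
  have hPm : MeasurableSet P := measurableSet_lt measurable_const hηm
  have hAm : MeasurableSet (ball x₀ δ ∩ P) := measurableSet_ball.inter hPm
  -- the avatar `T = φ(t₁, t₀, B(x₀, δ) ∩ {η(t₀) > 0})`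
  have hcont : Continuous (ODE.evolutionMap (fun t z => χ z • u t z) t₀ t₁) :=
    (hL.contDiff_evolutionMap hSc hSo.uniqueDiffOn le_top hwsmooth ht₀S ht₁S).continuous
  have hinj : InjOn (ODE.evolutionMap (fun t z => χ z • u t z) t₀ t₁) (ball x₀ δ ∩ P) :=
    (hL.bijective_evolutionMap hSc ht₀S ht₁S).injective.injOn
  refine ⟨ODE.evolutionMap (fun t z => χ z • u t z) t₀ t₁ '' (ball x₀ δ ∩ P),
    hAm.image_of_continuousOn_injOn hcont.continuousOn hinj, ?_, ?_⟩
  · rintro _ ⟨x, ⟨hx, hxP⟩, rfl⟩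
    rw [htrans x hx]
    exact ⟨hxP, hηW x hx⟩
  · -- the part of the ball where `η(t₀) = 0` carries no mass
    have hsplit : ∫⁻ x in ball x₀ δ, ENNReal.ofReal (‖curl (u t₀) x‖ / cylRadius x) =
        ∫⁻ x in ball x₀ δ ∩ P, ENNReal.ofReal (‖curl (u t₀) x‖ / cylRadius x) := by
      have e : ∫⁻ x in ball x₀ δ, ENNReal.ofReal (‖curl (u t₀) x‖ / cylRadius x) =
          ∫⁻ x in ball x₀ δ, P.indicator (fun x => ENNReal.ofReal (‖curl (u t₀) x‖ / cylRadius x)) x := by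
        refine setLIntegral_congr_fun measurableSet_ball fun x _ => ?_
        by_cases hxP : x ∈ P
        · rw [indicator_of_mem hxP]
        · rw [indicator_of_notMem hxP, ENNReal.ofReal_eq_zero.2 (not_lt.1 hxP)]
      rw [e, lintegral_indicator hPm, Measure.restrict_restrict hPm, inter_comm]
    rw [hsplit]
    calc ∫⁻ x in ball x₀ δ ∩ P, ENNReal.ofReal (‖curl (u t₀) x‖ / cylRadius x)
        = ∫⁻ x in ball x₀ δ ∩ P, ENNReal.ofReal (‖curl (u t₁) (ODE.evolutionMap (fun t z => χ z • u t z) t₀ t₁ x)‖ /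
            cylRadius (ODE.evolutionMap (fun t z => χ z • u t z) t₀ t₁ x)) :=
          setLIntegral_congr_fun hAm fun x hx => by rw [htrans x hx.1]
      _ ≤ ∫⁻ y in ODE.evolutionMap (fun t z => χ z • u t z) t₀ t₁ '' (ball x₀ δ ∩ P),
            ENNReal.ofReal (‖curl (u t₁) y‖ / cylRadius y) :=
          lintegral_comp_evolutionMap_le hL hwsmooth hSc hSo.uniqueDiffOn ht₀S ht₁S hAm (fun x hx => hdet x hx.1)
            (mapsTo_image _ _) fun y => ENNReal.ofReal (‖curl (u t₁) y‖ / cylRadius y)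

end Summit.NavierStokesRegularity.NavierStokesRegularity.Theorems.PowerGaugeEulerLiouville.MirrorMoment

end
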